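import Mathlib.NumberTheory.NumberField.ClassNumber
import Mathlib.RingTheory.RootsOfUnity.EnoughRootsOfUnity
import Mathlib.RingTheory.RootsOfUnity.AlgebraicallyClosed
import Mathlib.Analysis.Complex.Polynomial.Basic
import Mathlib.GroupTheory.Index
import Mathlib.GroupTheory.FiniteAbelian.Duality
import Literature.NumberTheory.EllipticCurves.Tian2014.CongruentNumbersHeegnerPoints
import HarnessLib

/-!
# Two group-theoretic lemmas behind the Rédei–Reichardt `4`-rank formula

Topic `NumberTheory/QuadraticFields`, namespace `Literature.NumberTheory.QuadraticFields.RedeiReichardt`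
(companions of `RedeiMatrixFourRank.lean`).  Theorem-only file (no definition, no named fact).

The Rédei–Reichardt theorem (`redeiReichardt_fourTwoCard_classGroup`; Rédei–Reichardt 1934, Li–Ma 2008
Thm. 0.4, Stevenhagen 1995 §2 Thm. 1) computes `#(Cl² ∩ Cl[2]) = 2^{r₄}` (the tree's
`Tian2014.fourTwoCard`) for an imaginary quadratic field.  Its proof (Stevenhagen §2: "an ambiguous
ideal class is a square iff all genus characters vanish on it") uses two facts about a finite abelian
group `G` that are isolated here:

* `isSquare_iff_forall_character_sq_eq_one` — **`G²` is the common kernel of the real characters**: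
  `x ∈ G²` iff `χ(x) = 1` for every character `χ : G →* ℂˣ` with `χ² = 1` (duality for the elementary
  abelian `2`-group `G/G²`: its characters separate points,
  `CommGroup.exists_apply_ne_one_of_hasEnoughRootsOfUnity`);
* `two_mul_fourTwoCard_eq_natCard` — **counting through a `2 : 1` parametrisation of `G[2]`**: if
  `φ : V →* G` has kernel of order `2` and image exactly `G[2] = {a : a² = 1}`, then
  `2 · #(G² ∩ G[2]) = #{v ∈ V : φ(v) ∈ G²}`.  (In the application `V = 𝔽₂^t`, `φ(e) = ∏ [𝔭ᵢ]^{eᵢ}` over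
  the ramified primes, `ker φ = {0, (1,…,1)}` up to the prime `2`, and `φ(e) ∈ Cl²` is the linear
  condition `R e = 0` of the Rédei matrix, whence `2 · 2^{r₄} = 2^{t − rank R}`.)

## References

* P. Stevenhagen, *Rédei-matrices and applications*, LMS Lecture Note Ser. 215 (1995), §2 (proof of
  Thm. 1). [Stevenhagen1995RedeiMatrices]
* L. Rédei, H. Reichardt, J. reine angew. Math. 170 (1934), 69–74. [RedeiReichardt1934]
-/

noncomputable section

open Literature.NumberTheory.EllipticCurves.Tian2014 (fourTwoCard)

namespace Literature.NumberTheory.QuadraticFields.RedeiReichardt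

/-! ### Squares and real characters -/

/-- In a commutative group, `x` is a square iff it lies in the range of `g ↦ g²`. [folklore] -/
private theorem isSquare_iff_mem_range_powMonoidHom {G : Type*} [CommGroup G] (x : G) :
    IsSquare x ↔ x ∈ (powMonoidHom 2 : G →* G).range := by
  rw [MonoidHom.mem_range]
  constructor
  · rintro ⟨r, hr⟩
    exact ⟨r, by rw [powMonoidHom_apply, pow_two, hr]⟩
  · rintro ⟨r, hr⟩
    exact ⟨r, by rw [← hr, powMonoidHom_apply, pow_two]⟩

/-- **`G²` is the common kernel of the real characters of a finite abelian group `G`**: `x` is a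
square iff `χ(x) = 1` for every `χ : G →* ℂˣ` with `χ² = 1` (the characters of the elementary abelian
`2`-group `G/G²` separate its points).  In genus theory: an ideal class is a square iff every genus
character is trivial on it. [cite: Stevenhagen1995RedeiMatrices, §2 (proof of Thm. 1)] -/
theorem isSquare_iff_forall_character_sq_eq_one {G : Type*} [CommGroup G] [Finite G] (x : G) :
    IsSquare x ↔ ∀ χ : G →* ℂˣ, χ * χ = 1 → χ x = 1 := by
  classical
  constructor
  · rintro ⟨r, rfl⟩ χ hχ
    rw [map_mul, ← MonoidHom.mul_apply, hχ, MonoidHom.one_apply]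
  · intro h
    by_contra hx
    set H : Subgroup G := (powMonoidHom 2 : G →* G).range with hH
    have hxH : x ∉ H := fun hmem => hx ((isSquare_iff_mem_range_powMonoidHom x).mpr hmem)
    have hne : (QuotientGroup.mk x : G ⧸ H) ≠ 1 := by
      rwa [Ne, QuotientGroup.eq_one_iff]
    haveI : NeZero ((Monoid.exponent (G ⧸ H) : ℕ) : ℂ) :=
      ⟨Nat.cast_ne_zero.mpr Monoid.exponent_ne_zero_of_finite⟩
    haveI : HasEnoughRootsOfUnity ℂ (Monoid.exponent (G ⧸ H)) := inferInstance
    obtain ⟨χ', hχ'⟩ := CommGroup.exists_apply_ne_one_of_hasEnoughRootsOfUnity (G ⧸ H) ℂ hne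
    set χ : G →* ℂˣ := χ'.comp (QuotientGroup.mk' H) with hχdef
    have hχ2 : χ * χ = 1 := by
      ext g
      rw [MonoidHom.mul_apply, MonoidHom.one_apply, hχdef, MonoidHom.comp_apply, ← map_mul,
        QuotientGroup.mk'_apply, ← QuotientGroup.mk_mul,
        (QuotientGroup.eq_one_iff (g * g)).mpr
          (MonoidHom.mem_range.mpr ⟨g, by rw [powMonoidHom_apply, pow_two]⟩), map_one]
    exact hχ' (h χ hχ2)

/-! ### Counting `G² ∩ G[2]` through a two-to-one parametrisation of `G[2]` -/

/-- **Counting lemma.**  Let `φ : V →* G` be a homomorphism of finite abelian groups whose kernel has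
exactly two elements and whose image is the `2`-torsion `G[2] = {a : a² = 1}`.  Then
`2 · #{a ∈ G : a square, a² = 1} = #{v ∈ V : φ(v) a square}` — i.e. `2 · fourTwoCard G` equals the
number of parameters whose class is a square (Stevenhagen, proof of Thm. 1: the ambiguous classes
are parametrised two-to-one by the subsets of the ramified primes, and
`r₄ = dim{e : the class of e is a square} − 1`). [cite: Stevenhagen1995RedeiMatrices, §2 (proof of Thm. 1)] -/
theorem two_mul_fourTwoCard_eq_natCard {V G : Type*} [CommGroup V] [Finite V] [CommGroup G]
    [Finite G] (φ : V →* G) (hker : Nat.card φ.ker = 2)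
    (hrange : ∀ a : G, a ^ 2 = 1 ↔ a ∈ φ.range) :
    2 * fourTwoCard G = Nat.card {v : V // IsSquare (φ v)} := by
  classical
  rw [fourTwoCard]
  set H : Subgroup G := (powMonoidHom 2 : G →* G).range with hH
  -- the subgroup `S' = φ⁻¹(G²)` of `V` and the restriction `ψ = φ|_{S'}`
  set S' : Subgroup V := H.comap φ with hS'
  set ψ : S' →* G := φ.comp S'.subtype with hψ
  -- `#S' = #ker ψ · #range ψ`
  have hcard : Nat.card S' = Nat.card ψ.ker * Nat.card ψ.range := by
    rw [← Subgroup.index_ker, Subgroup.card_mul_index]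
  -- `ker ψ ≃ ker φ`
  have hmemkerψ : ∀ v : S', v ∈ ψ.ker ↔ (v : V) ∈ φ.ker := fun v => by
    rw [MonoidHom.mem_ker, MonoidHom.mem_ker]
    rfl
  have hkerψ : Nat.card ψ.ker = Nat.card φ.ker := by
    refine Nat.card_congr ?_
    refine
      { toFun := fun v => ⟨(v.1 : V), (hmemkerψ v.1).mp v.2⟩
        invFun := fun v => ⟨⟨v.1, by
          have h1 : φ v.1 = 1 := (MonoidHom.mem_ker).mp v.2
          rw [hS', Subgroup.mem_comap, h1]
          exact one_mem H⟩, (hmemkerψ _).mpr v.2⟩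
        left_inv := fun v => Subtype.ext (Subtype.ext rfl)
        right_inv := fun v => Subtype.ext rfl }
  -- `range ψ = {a : a square ∧ a² = 1}`
  have hrangeψ : Nat.card ψ.range = Nat.card {a : G // IsSquare a ∧ a ^ 2 = 1} := by
    refine Nat.card_congr (Equiv.subtypeEquivRight fun a => ?_)
    rw [MonoidHom.mem_range]
    constructor
    · rintro ⟨⟨v, hv⟩, rfl⟩
      rw [hS', Subgroup.mem_comap] at hv
      refine ⟨(isSquare_iff_mem_range_powMonoidHom _).mpr hv, (hrange _).mpr ⟨v, rfl⟩⟩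
    · rintro ⟨hsq, h2⟩
      obtain ⟨v, rfl⟩ := (hrange _).mp h2
      exact ⟨⟨v, by rw [hS', Subgroup.mem_comap]; exact (isSquare_iff_mem_range_powMonoidHom _).mp hsq⟩,
        rfl⟩
  -- `S' = {v : φ v a square}`
  have hS'card : Nat.card S' = Nat.card {v : V // IsSquare (φ v)} := by
    refine Nat.card_congr (Equiv.subtypeEquivRight fun v => ?_)
    rw [hS', Subgroup.mem_comap, isSquare_iff_mem_range_powMonoidHom]
  rw [← hS'card, hcard, hkerψ, hker, hrangeψ]

end Literature.NumberTheory.QuadraticFields.RedeiReichardt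

end
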